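import Literature.Analysis.FluidPDE.DynamicRescalingVelocityRateEventually
import Literature.Analysis.FluidPDE.KNSSNoAxisymmetricTypeIHolds
import HarnessLib

/-!
# In the axisymmetric class a dynamic rescaling with ratio pinned AT OR ABOVE Leray's `½` and
# bounded rescaled speed is not a blow-up (drifting-exponent form of the Type I exclusion)

Topic `Literature/Analysis/FluidPDE`; third part of `DynamicRescalingVelocityRate.lean` /
`DynamicRescalingVelocityRateEventually.lean` (same setting and notation: continuous exponents
`c_u, c_l`, time clock `C_u = rescalingFactor c_u` pinned by `−b ≤ c_u ≤ −a < 0` on `[0, ∞)`,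
`t = rescaledTime C_u`, `T = blowupTime C_u`, length clock `C_l = rescalingFactor (−c_l)`, ratio
`ĉ_l = c_l/|c_u|`; Hou 2026 §3, pp. 10–11 of the held text).

The first two files exclude the SUB-Leray side `ĉ_l ≥ γ > ½` through Leray's rate, in every
symmetry class. At Leray's value itself the envelope is the Type I bound `|u| ≤ C/√(T − t)`,
which Leray's rate does not exclude — but in the AXISYMMETRIC class the tree's discharged ns.S24
does (`knss_no_axisymmetric_typeI_holds`: Koch–Nadirashvili–Seregin–Šverák 2009 Thm 6.2 /
Seregin–Šverák 2009 Thm 1.1; exact-ansatz version `isTypeIBlowup_selfSimilarCollapse`, the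
census hook H3 of the `ns-blowup` profile zones). This file records the drifting-exponent form:

* `isTypeIBlowup_of_lengthFactor_le`: pinned clock, `C_l ≤ K C_u^γ` on `[0, ∞)` with `γ ≥ ½`
  (in particular a ratio pinned `≥ ½` after a transient,
  `exists_lengthFactor_le_mul_rpow_clockFactor_of_eventually`) and bounded rescaled speed
  `(C_u/C_l)(τ) F(t(τ), x) ≤ M` ⇒ the Type I bound `F(s, x) ≤ C/√(T − s)` on `[0, T)`, hence
  `IsTypeIBlowup u T` for `F = |u|`, and boundedness on every earlier slab
  (`exists_bound_Icc_of_lengthFactor_le`).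
* `not_isMaximalSmoothSolution_of_rescaling_of_axisymmetric`: `ν > 0`, pinned clock, ratio
  `½ (−c_u(s)) ≤ c_l(s)` for `s ≥ τ₀` (Leray's value ALLOWED), a maximal smooth Leray–Hopf
  solution of the unforced system with lifespan `T = t(∞)`, axisymmetric on `[0, T)`, with
  bounded rescaled speed ⇒ `False`. Read on a computed axisymmetric clock: a genuine blow-up at
  `t(∞)` with `ĉ_l(τ) ≥ ½` from some time on REQUIRES `limsup ‖ũ(τ)‖_∞ = ∞` (the zones' "V-T2
  print"), and `ĉ_l` pinned below `½` kills the swirl (`DynamicRescalingCirculationClock.lean`).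

## WHAT THIS IS NOT
Bookkeeping plus one composition with a kernel theorem; no profile is constructed, no existence
or blow-up is asserted, nothing is claimed about any computed trajectory.
-/

noncomputable section

open MeasureTheory Set Filter Function
open _root_.Topology

namespace Literature.Analysis.FluidPDE

section TypeI

variable {cu cl : ℝ → ℝ} {X : Type*} {F : ℝ → X → ℝ} {M : ℝ}

/-- **Type I envelope from a dominated length clock.** If `−b ≤ c_u ≤ −a < 0` on `[0, ∞)`,
`C_l(τ) ≤ K C_u(τ)^γ` for `τ ≥ 0` with `K ≥ 0`, `γ ≥ ½`, and a nonnegative size functional has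
bounded rescaled profile in the velocity normalisation, `(C_u/C_l)(τ) F(t(τ), x) ≤ M`, then
`F(s, x) ≤ (M K b^{γ−½} a^{−½} T^{γ−½}) / √(T − s)` for all `s ∈ [0, T)` and `x` — the Type I
shape of `IsTypeIBlowup` (`(T − s)^{γ−1} = (T−s)^{γ−½}/√(T−s) ≤ T^{γ−½}/√(T−s)`).
[cite: Hou2026, §3 (rescaled profiles; scaling formulas 1/C_u = 1/(T−t), C_lz = (T−t)^{ĉ_lz})] -/
theorem typeI_bound_of_lengthFactor_le (hcu : Continuous cu) {a b : ℝ} (ha : 0 < a)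
    (hca : ∀ s, 0 ≤ s → cu s ≤ -a) (hcb : ∀ s, 0 ≤ s → -b ≤ cu s) {γ : ℝ} (hγ : 1 / 2 ≤ γ)
    {K : ℝ} (hK : 0 ≤ K)
    (hKl : ∀ τ, 0 ≤ τ → rescalingFactor (fun s => -cl s) τ ≤ K * rescalingFactor cu τ ^ γ)
    (hF0 : ∀ s x, 0 ≤ F s x)
    (hF : ∀ τ, 0 ≤ τ → ∀ x, rescalingFactor cu τ / rescalingFactor (fun s => -cl s) τ *
      F (rescaledTime (rescalingFactor cu) τ) x ≤ M)
    {s : ℝ} (hs : s ∈ Ico 0 (blowupTime (rescalingFactor cu))) (x : X) :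
    F s x ≤ M * K * (b ^ (γ - 1 / 2) * a ^ (-(1 / 2 : ℝ))) *
      blowupTime (rescalingFactor cu) ^ (γ - 1 / 2) / Real.sqrt (blowupTime (rescalingFactor cu) - s) := by
  set T := blowupTime (rescalingFactor cu) with hT
  have hTs : 0 < T - s := sub_pos.2 hs.2
  have h := speed_le_of_lengthFactor_le hcu ha hca hcb hγ hK hKl hF0 hF hs x
  -- the constant in front is nonnegative
  have hM : 0 ≤ M := by
    have h0 := hF0 (rescaledTime (rescalingFactor cu) 0) x
    have h1 := hF 0 le_rfl x
    exact le_trans (mul_nonneg (div_pos (rescalingFactor_pos _ _) (rescalingFactor_pos _ _)).le h0) h1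
  have hb : 0 ≤ b := by
    have h1 := rescalingFactor_le_mul_sub_rescaledTime hcu ha hca hcb (le_refl (0 : ℝ))
    have hd : 0 < T - rescaledTime (rescalingFactor cu) 0 := by
      rw [rescaledTime_zero, sub_zero]
      exact blowupTime_pos (continuous_rescalingFactor hcu) (rescalingFactor_pos cu)
        (integrableOn_rescalingFactor hcu ha hca)
    exact (pos_of_mul_pos_left ((rescalingFactor_pos cu 0).trans_le h1) hd.le).le
  have hC0 : 0 ≤ M * K * (b ^ (γ - 1 / 2) * a ^ (-(1 / 2 : ℝ))) :=
    mul_nonneg (mul_nonneg hM hK) (mul_nonneg (Real.rpow_nonneg hb _) (Real.rpow_nonneg ha.le _))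
  -- `(T − s)^{γ−1} ≤ T^{γ−½} / √(T − s)`
  have hpow : (T - s) ^ (γ - 1) ≤ T ^ (γ - 1 / 2) / Real.sqrt (T - s) := by
    rw [le_div_iff₀ (Real.sqrt_pos.2 hTs), Real.sqrt_eq_rpow, ← Real.rpow_add hTs,
      show γ - 1 + 1 / 2 = γ - 1 / 2 by ring]
    exact Real.rpow_le_rpow hTs.le (by linarith [hs.1]) (by linarith)
  calc F s x ≤ M * K * (b ^ (γ - 1 / 2) * a ^ (-(1 / 2 : ℝ))) * (T - s) ^ (γ - 1) := h
    _ ≤ M * K * (b ^ (γ - 1 / 2) * a ^ (-(1 / 2 : ℝ))) * (T ^ (γ - 1 / 2) / Real.sqrt (T - s)) :=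
        mul_le_mul_of_nonneg_left hpow hC0
    _ = M * K * (b ^ (γ - 1 / 2) * a ^ (-(1 / 2 : ℝ))) * T ^ (γ - 1 / 2) / Real.sqrt (T - s) := by
        ring

/-- **Boundedness on the earlier slabs from a dominated length clock.** Under the hypotheses of
`typeI_bound_of_lengthFactor_le`, for every `T' < T` the functional is bounded on `[0, T']`:
`∃ V, ∀ s ∈ [0, T'], ∀ x, F(s, x) ≤ V` (the hypothesis shape of ns.S24 / the swirl maximum
principle). [cite: Hou2026, §3 (rescaled profiles; scaling formulas)] -/
theorem exists_bound_Icc_of_lengthFactor_le (hcu : Continuous cu) {a b : ℝ} (ha : 0 < a)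
    (hca : ∀ s, 0 ≤ s → cu s ≤ -a) (hcb : ∀ s, 0 ≤ s → -b ≤ cu s) {γ : ℝ} (hγ : 1 / 2 ≤ γ)
    {K : ℝ} (hK : 0 ≤ K)
    (hKl : ∀ τ, 0 ≤ τ → rescalingFactor (fun s => -cl s) τ ≤ K * rescalingFactor cu τ ^ γ)
    (hF0 : ∀ s x, 0 ≤ F s x)
    (hF : ∀ τ, 0 ≤ τ → ∀ x, rescalingFactor cu τ / rescalingFactor (fun s => -cl s) τ *
      F (rescaledTime (rescalingFactor cu) τ) x ≤ M)
    {T' : ℝ} (hT' : T' < blowupTime (rescalingFactor cu)) :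
    ∃ V : ℝ, ∀ s ∈ Icc 0 T', ∀ x, F s x ≤ V := by
  set T := blowupTime (rescalingFactor cu) with hT
  set C := M * K * (b ^ (γ - 1 / 2) * a ^ (-(1 / 2 : ℝ))) * T ^ (γ - 1 / 2) with hC
  have hTT' : 0 < T - T' := sub_pos.2 hT'
  refine ⟨|C| / Real.sqrt (T - T'), fun s hs x => ?_⟩
  have hsT : s ∈ Ico 0 T := ⟨hs.1, hs.2.trans_lt hT'⟩
  have hTs : 0 < T - s := sub_pos.2 hsT.2
  have h := typeI_bound_of_lengthFactor_le hcu ha hca hcb hγ hK hKl hF0 hF hsT x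
  have hsq : Real.sqrt (T - T') ≤ Real.sqrt (T - s) := Real.sqrt_le_sqrt (by linarith [hs.2])
  have hsq' : 0 < Real.sqrt (T - T') := Real.sqrt_pos.2 hTT'
  calc F s x ≤ C / Real.sqrt (T - s) := h
    _ ≤ |C| / Real.sqrt (T - s) := div_le_div_of_nonneg_right (le_abs_self C) (Real.sqrt_nonneg _)
    _ ≤ |C| / Real.sqrt (T - T') := div_le_div_of_nonneg_left (abs_nonneg C) hsq' hsq

/-- **Type I along the clock.** With `−b ≤ c_u ≤ −a < 0` and `C_l ≤ K C_u^γ` on `[0, ∞)`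
(`K ≥ 0`, `γ ≥ ½`) and bounded rescaled speed `(C_u/C_l)(τ) |u(t(τ), x)| ≤ M`, the velocity field
obeys the Type I bound at `T = t(∞)`: `IsTypeIBlowup u T` (drifting-exponent form of
`isTypeIBlowup_selfSimilarCollapse`). [cite: Hou2026, §3 (scaling formulas; blowup rates)] -/
theorem isTypeIBlowup_of_lengthFactor_le (hcu : Continuous cu) {a b : ℝ} (ha : 0 < a)
    (hca : ∀ s, 0 ≤ s → cu s ≤ -a) (hcb : ∀ s, 0 ≤ s → -b ≤ cu s) {γ : ℝ} (hγ : 1 / 2 ≤ γ)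
    {K : ℝ} (hK : 0 ≤ K)
    (hKl : ∀ τ, 0 ≤ τ → rescalingFactor (fun s => -cl s) τ ≤ K * rescalingFactor cu τ ^ γ)
    {u : ℝ → EuclideanSpace ℝ (Fin 3) → EuclideanSpace ℝ (Fin 3)}
    (hM : ∀ τ, 0 ≤ τ → ∀ x, rescalingFactor cu τ / rescalingFactor (fun s => -cl s) τ *
      ‖u (rescaledTime (rescalingFactor cu) τ) x‖ ≤ M) :
    IsTypeIBlowup u (blowupTime (rescalingFactor cu)) := by
  have hT := blowupTime_pos (continuous_rescalingFactor hcu) (rescalingFactor_pos cu)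
    (integrableOn_rescalingFactor hcu ha hca)
  refine ⟨M * K * (b ^ (γ - 1 / 2) * a ^ (-(1 / 2 : ℝ))) *
    blowupTime (rescalingFactor cu) ^ (γ - 1 / 2), ?_⟩
  filter_upwards [Ioo_mem_nhdsLT hT] with s hs x
  exact typeI_bound_of_lengthFactor_le hcu ha hca hcb hγ hK hKl (fun _ _ => norm_nonneg _) hM
    ⟨hs.1.le, hs.2⟩ x

end TypeI

/-! ### Composition with ns.S24 (no axisymmetric Type I blow-up) -/

section Axisymmetric

variable {cu cl : ℝ → ℝ}

/-- **No axisymmetric blow-up along a clock with ratio pinned at or above `½`.** Let `ν > 0`, let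
the exponents be continuous with `−b ≤ c_u ≤ −a < 0` on `[0, ∞)` and `½ (−c_u(s)) ≤ c_l(s)` for
`s ≥ τ₀` (`ĉ_l ≥ ½` after a transient — Leray's value allowed), and let `(u, p)` be a maximal
smooth solution of the unforced Navier–Stokes system with lifespan `T = t(∞)`
(`IsMaximalSmoothSolution ν 0 u p T`), Leray–Hopf from `u 0`, axisymmetric at every
`t ∈ [0, T)`, with bounded rescaled speed `(C_u/C_l)(τ) |u(t(τ), x)| ≤ M` for all `τ ≥ 0`. Then
`False`: the solution is Type I at `T` and bounded on earlier slabs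
(`isTypeIBlowup_of_lengthFactor_le`, `exists_bound_Icc_of_lengthFactor_le`), so ns.S24
(`knss_no_axisymmetric_typeI_holds`, KNSS 2009 Thm 6.2 / Seregin–Šverák 2009) extends it past `T`.
[cite: KochNadirashviliSereginSverak2009, Thm 6.1 and Thm 6.2 (§6, arXiv numbering)] -/
theorem not_isMaximalSmoothSolution_of_rescaling_of_axisymmetric {ν : ℝ} (hν : 0 < ν)
    (hcu : Continuous cu) (hcl : Continuous cl) {a b : ℝ} (ha : 0 < a)
    (hca : ∀ s, 0 ≤ s → cu s ≤ -a) (hcb : ∀ s, 0 ≤ s → -b ≤ cu s) {τ₀ : ℝ}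
    (hratio : ∀ s, τ₀ ≤ s → 1 / 2 * (-cu s) ≤ cl s)
    {u : ℝ → EuclideanSpace ℝ (Fin 3) → EuclideanSpace ℝ (Fin 3)}
    {p : ℝ → EuclideanSpace ℝ (Fin 3) → ℝ}
    (hmax : IsMaximalSmoothSolution ν 0 u p (blowupTime (rescalingFactor cu)))
    (hLH : IsLerayHopfOn (blowupTime (rescalingFactor cu)) ν 0 (u 0) u)
    (haxi : ∀ t ∈ Ico 0 (blowupTime (rescalingFactor cu)), IsAxisymmetric (u t)) {M : ℝ}
    (hM : ∀ τ, 0 ≤ τ → ∀ x, rescalingFactor cu τ / rescalingFactor (fun s => -cl s) τ *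
      ‖u (rescaledTime (rescalingFactor cu) τ) x‖ ≤ M) : False := by
  obtain ⟨K, hK, hKl⟩ :=
    exists_lengthFactor_le_mul_rpow_clockFactor_of_eventually hcu hcl (γ := 1 / 2) hratio
  have hT := blowupTime_pos (continuous_rescalingFactor hcu) (rescalingFactor_pos cu)
    (integrableOn_rescalingFactor hcu ha hca)
  have htypeI := isTypeIBlowup_of_lengthFactor_le hcu ha hca hcb le_rfl hK.le hKl hM
  have hbdd : ∀ T' < blowupTime (rescalingFactor cu), ∃ V : ℝ, ∀ t ∈ Icc 0 T', ∀ x, ‖u t x‖ ≤ V :=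
    fun T' hT' => exists_bound_Icc_of_lengthFactor_le hcu ha hca hcb le_rfl hK.le hKl
      (fun _ _ => norm_nonneg _) hM hT'
  exact hmax.2 (knss_no_axisymmetric_typeI_holds hν hT hmax.1 hLH hbdd haxi (Or.inl htypeI))

/-- **The reading on a series.** Under the same clock, boundedness and symmetry hypotheses, for a
maximal smooth axisymmetric Leray–Hopf solution with lifespan `t(∞)` and bounded rescaled speed,
the ratio returns STRICTLY BELOW Leray's value at arbitrarily late rescaled times: for every `τ₀`
there is `s ≥ τ₀` with `c_l(s) < ½ (−c_u(s))` (`ĉ_l(s) < ½`).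
[cite: KochNadirashviliSereginSverak2009, Thm 6.1 and Thm 6.2 (§6, arXiv numbering)] -/
theorem exists_ratio_lt_half_of_isMaximalSmoothSolution_of_axisymmetric {ν : ℝ} (hν : 0 < ν)
    (hcu : Continuous cu) (hcl : Continuous cl) {a b : ℝ} (ha : 0 < a)
    (hca : ∀ s, 0 ≤ s → cu s ≤ -a) (hcb : ∀ s, 0 ≤ s → -b ≤ cu s)
    {u : ℝ → EuclideanSpace ℝ (Fin 3) → EuclideanSpace ℝ (Fin 3)}
    {p : ℝ → EuclideanSpace ℝ (Fin 3) → ℝ}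
    (hmax : IsMaximalSmoothSolution ν 0 u p (blowupTime (rescalingFactor cu)))
    (hLH : IsLerayHopfOn (blowupTime (rescalingFactor cu)) ν 0 (u 0) u)
    (haxi : ∀ t ∈ Ico 0 (blowupTime (rescalingFactor cu)), IsAxisymmetric (u t)) {M : ℝ}
    (hM : ∀ τ, 0 ≤ τ → ∀ x, rescalingFactor cu τ / rescalingFactor (fun s => -cl s) τ *
      ‖u (rescaledTime (rescalingFactor cu) τ) x‖ ≤ M) (τ₀ : ℝ) :
    ∃ s, τ₀ ≤ s ∧ cl s < 1 / 2 * (-cu s) := by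
  by_contra h
  push Not at h
  exact not_isMaximalSmoothSolution_of_rescaling_of_axisymmetric hν hcu hcl ha hca hcb h hmax hLH
    haxi hM

end Axisymmetric

end Literature.Analysis.FluidPDE

end
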